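import Summits.HodgeConjecture.HodgeConjecture.Theorems.HodgeLocusCensusSchema
import Literature.AlgebraicGeometry.MovasatiVillaflor2018.LinearCyclePeriods
import HarnessLib

/-!
# HodgeLocusCensusLinearCycleRank — PROVED for ALL (n, d, a, b): the period matrix of every linear cycle of the Fermat
# variety has rank `binom(n/2+d, d) − (n/2+1)²` (cell pub-hlocus, lit-g15 bridge; supersedes the enumerated
# `HodgeLocusCensusPlaneRank{,6,8}` instances `(n,d) = (4,4), (6,4), (8,4)`, `b = id`)
HONEST FRAMING: certified instances and evidence bearing on the general Hodge conjecture; no claim.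

The census certificate `IvhsRankEq n d r [(c, P_{a,b})]` (rank of Movasati's matrix `[p_{i+j}]` at the MV18 periods
of ONE linear cycle, any non-zero rational coefficient) holds with `r = binom(n/2+d, d) − (n/2+1)²` for every even `n`
and every `d ≥ 2 + 4/n` (`n + 2 ≤ (n/2)·d`), every twist vector `a` and every permutation `b` — Movasati, Asian J.
Math. 21 (2017) Thm. 2 / §3.5 and arXiv:1602.06607 eq. after Thm. 7, as the Literature theorem
`Literature.AlgebraicGeometry.MovasatiVillaflor2018.rank_periodMatrix_linearCycle` (rank = Hilbert function of the
Voisin–Otwinowska ideal `⟨x_{b(2e)} − ζ^{1+2a_{2e+1}}x_{b(2e+1)}, x_i^{d−1}⟩` in degree `d`). This file only identifies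
the census matrix with the Literature one (`ivhsMatrix_single`, by `rfl` on the entries).
-/

namespace Summit.HodgeConjecture.HodgeConjecture.HodgeLocus.Census

open Literature.AlgebraicGeometry

/-- The census period of a linear cycle is MV18's normalised period (same formula). -/
theorem period_eq_linearCyclePeriod {K : Type*} [Field K] (n d : ℕ) (ζ : K) (P : LinearCycle n)
    (i : Fin (n+2) → ℕ) :
    period n d ζ P i = MovasatiVillaflor2018.linearCyclePeriod n d ζ P.a P.b i := by
  unfold period MovasatiVillaflor2018.linearCyclePeriod
  convert rfl

/-- The census matrix of `c·[P_{a,b}]` is Movasati's period matrix at `c` times MV18's period vector. -/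
theorem ivhsMatrix_single {K : Type*} [Field K] (n d : ℕ) (ζ : K) (c : ℚ) (P : LinearCycle n) :
    ivhsMatrix n d ζ [(c, P)] =
      Movasati2016.periodMatrix (n+2) d (n/2*d-n-2) d
        (fun i => (c : K) * MovasatiVillaflor2018.linearCyclePeriod n d ζ P.a P.b i) := by
  ext i j
  simp only [ivhsMatrix, periodComb, List.map, List.sum_cons, List.sum_nil, add_zero, period_eq_linearCyclePeriod,
    Movasati2016.periodMatrix_apply]

/-- **EVERY single-linear-cycle row of the census, all (n, d, a, b) at once**: for `n` even, `n + 2 ≤ (n/2)·d`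
(`d ≥ 2 + 4/n`) and `c ≠ 0`, `IvhsRankEq n d (binom(n/2+d,d) − (n/2+1)²) [(c, P)]`. -/
theorem ivhsRankEq_linearCycle {n d : ℕ} (hn : Even n) (hN : n + 2 ≤ n / 2 * d) {c : ℚ} (hc : c ≠ 0)
    (P : LinearCycle n) : IvhsRankEq n d ((n / 2 + d).choose d - (n / 2 + 1) ^ 2) [(c, P)] := by
  intro K _ _ ζ hζ
  have hd0 : 2 * d ≠ 0 := fun h => by
    have hd : d = 0 := by omega
    subst hd
    simp at hN
  rw [ivhsMatrix_single]
  exact MovasatiVillaflor2018.rank_periodMatrix_linearCycle hn hN (hζ.ne_zero hd0) P.a P.b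
    (by exact_mod_cast hc)

/-- The explained row shape for the locus of hypersurfaces containing a linear `ℙ^{n/2}` (codimension
`binom(n/2+d,d) − (n/2+1)²`, Movasati 2017 Thm. 2), every linear cycle of every Fermat variety with `d ≥ 2 + 4/n`. -/
theorem explainedSmooth_linearCycle {n d : ℕ} (hn : Even n) (hN : n + 2 ≤ n / 2 * d) (P : LinearCycle n) :
    ExplainedSmoothRow n d ((n / 2 + d).choose d - (n / 2 + 1) ^ 2) [(1, P)] :=
  ivhsRankEq_linearCycle hn hN one_ne_zero P

/-- Instances re-derived: the (4,4) planes (rank 6), the (6,4) 3-planes (19), the (8,4) 4-planes (45), and — new —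
every cubic row `L = binom(n/2+1, 3)` (e.g. (6,3): 4, (8,3): 10, (10,3): 20) and the sextic fourfold (19 = binom(8,6) − 9). -/
theorem ivhsRankEq_standardP_4_4 : IvhsRankEq 4 4 6 [(1, standardP 4)] :=
  ivhsRankEq_linearCycle (n := 4) (d := 4) ⟨2, rfl⟩ (by norm_num) one_ne_zero _

/-- (6,3): the standard 3-plane of the cubic fourfold, rank `4 = binom(6,3) − 16`. -/
theorem ivhsRankEq_standardP_6_3 : IvhsRankEq 6 3 4 [(1, standardP 6)] :=
  ivhsRankEq_linearCycle (n := 6) (d := 3) ⟨3, rfl⟩ (by norm_num) one_ne_zero _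

/-- (10,3): the standard 5-plane of the cubic eightfold, rank `20 = binom(8,3) − 36`. -/
theorem ivhsRankEq_standardP_10_3 : IvhsRankEq 10 3 20 [(1, standardP 10)] :=
  ivhsRankEq_linearCycle (n := 10) (d := 3) ⟨5, rfl⟩ (by norm_num) one_ne_zero _

/-- (4,6): the standard plane of the sextic fourfold, rank `19 = binom(8,6) − 9`. -/
theorem ivhsRankEq_standardP_4_6 : IvhsRankEq 4 6 19 [(1, standardP 4)] :=
  ivhsRankEq_linearCycle (n := 4) (d := 6) ⟨2, rfl⟩ (by norm_num) one_ne_zero _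

/-! ## Every census row: `IvhsRankEq n d r δ` is the statement `HF_{J^{F,δ}}(d) = r` at the Fermat point -/

/-- The census matrix of ANY rational combination `δ` of linear cycles is Movasati's period matrix at the combination
of MV18 period vectors. -/
theorem ivhsMatrix_eq_periodMatrix {K : Type*} [Field K] (n d : ℕ) (ζ : K) (δ : List (ℚ × LinearCycle n)) :
    ivhsMatrix n d ζ δ = Movasati2016.periodMatrix (n+2) d (n/2*d-n-2) d
      (MovasatiVillaflor2018.combPeriod n d ζ (δ.map fun x => ((x.1 : K), x.2.a, x.2.b))) := by
  ext i j
  -- `period n d ζ P i` and `linearCyclePeriod n d ζ P.a P.b i` are the same term (closed by `rfl` inside `simp`)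
  simp only [ivhsMatrix, periodComb, Movasati2016.periodMatrix_apply, MovasatiVillaflor2018.combPeriod,
    List.map_map, period_eq_linearCyclePeriod, Function.comp_def]

/-- **The rank of the census matrix of `δ = Σ c_k [P_k]` is `HF_{J^{F,δ}}(d)`**, `J^{F,δ} = Ann(Σ c_k ℓ_{P_k})` the
Voisin–Otwinowska ideal of `δ` (Literature `MovasatiVillaflor2018.rank_periodMatrix_comb`, read on the census's
definitionally equal index types), for `n` even and `n + 2 ≤ (n/2)·d`, over any field. -/
theorem rank_ivhsMatrix_eq_hilbert {K : Type*} [Field K] {n d : ℕ} (hn : Even n) (hN : n + 2 ≤ n / 2 * d) (ζ : K)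
    (δ : List (ℚ × LinearCycle n)) :
    (ivhsMatrix n d ζ δ).rank =
      Module.finrank K (MvPolynomial.homogeneousSubmodule (Fin (n+2)) K d) -
        Module.finrank K (Literature.RingTheory.MvPolynomial.idealDegree
          (Kloosterman2025.annIdeal (MovasatiVillaflor2018.combFunctional n d ζ hn
            (δ.map fun x => ((x.1 : K), x.2.a, x.2.b)))) d) := by
  rw [ivhsMatrix_eq_periodMatrix]
  exact MovasatiVillaflor2018.rank_periodMatrix_comb ζ hn hN _

/-- **Engine A's certificate = engine B's Hilbert function, as a theorem**: for `n` even and `n + 2 ≤ (n/2)·d`,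
`IvhsRankEq n d r δ` holds iff over every characteristic-zero field with a primitive `2d`-th root of unity `ζ` the
Voisin–Otwinowska ideal `J^{F,δ} = Ann(Σ c_k ℓ_{P_k})` of `δ` has `dim S_d − dim J^{F,δ}_d = r`. -/
theorem ivhsRankEq_iff_hilbert {n d : ℕ} (hn : Even n) (hN : n + 2 ≤ n / 2 * d) (r : ℕ)
    (δ : List (ℚ × LinearCycle n)) :
    IvhsRankEq n d r δ ↔ ∀ (K : Type) [Field K] [CharZero K] (ζ : K), IsPrimitiveRoot ζ (2*d) →
      Module.finrank K (MvPolynomial.homogeneousSubmodule (Fin (n+2)) K d) -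
        Module.finrank K (Literature.RingTheory.MvPolynomial.idealDegree
          (Kloosterman2025.annIdeal (MovasatiVillaflor2018.combFunctional n d ζ hn
            (δ.map fun x => ((x.1 : K), x.2.a, x.2.b)))) d) = r := by
  refine forall₅_congr fun K _ _ ζ hζ => ?_
  rw [rank_ivhsMatrix_eq_hilbert hn hN ζ δ]

end Summit.HodgeConjecture.HodgeConjecture.HodgeLocus.Census
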